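import Literature.NumberTheory.IwasawaTheory.Greenberg2006.CoinducedModuleDual
import HarnessLib

/-!
# Functoriality of the Mahler dual datum of the co-induced module in the coefficients: adjoint matrices
# act on `T_A ⊗ Λ` (one and two variables) — the linear algebra behind the DETERMINANT form of
# Greenberg 2010 Lemma 5.2.2 for the twist deformation of a module of ANY corank
# (crux `AnticyclotomicEisensteinDivisibility`, stmt-BirchSwinnertonDyer-20727, line `bdpline`, brick (R1b)
# of `stub_finiteExponentSS`; helper for stmt-BirchSwinnertonDyer-20727)

Cell `bsd-ssimc` (hosting route `SignedBaseChange`), width seat `bsd-line-sbc-p1-w2` gen 4. The brick (R1b)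
of the Greenberg-2016 road for `stub_finiteExponentSS` (bsd-line-sbc-p1-w2 gen 3's note
`finite-exponent-greenberg-road-w2g3.md`; hypothesis `hR1b` of
`SignedBaseChangeAcDivNoPseudoNull.xGr₂_torsionBy_X_finiteExponent_of_bricks`, p627602) asks for
LOC_v⁽¹⁾(`𝐃`) and `corank H⁰(K_v, 𝐃) = 0` for the twist deformation `𝐃 = Ind_{K̃_∞/K}(E_K[p^∞])`, where a
decomposition group acts on `E[p^∞]` through a genuine `GL₂(ℤ_p)`-valued `ρ₀` — not by scalars, so the
corank-one theorems of cell `bsd-eis` (`TwistDeformationCofree.twistDeformation_LOC1`, scalar `t`) and the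
tree's `Greenberg2006.twistDeformation_LOC1_of_ne_one` (`ρ₀(σ) = 1`, `σ` fixing `μ_{p^∞}`) do not apply.
Greenberg's own argument ([Greenberg2010] Lemma 5.2.2, PDF p. 28: `T*` is free over the DOMAIN `Λ`, on which
`σ` acts as `κ(σ)⁻¹ ⊗ ρ₀*(σ)`; "a non-constant group-like element is no eigenvalue of a matrix over `ℤ_p`")
needs, on the module side, that the Mahler dual datum `T_A ⊗ Λ ≅ Hom(Ind(A), C)` of the tree
(`BigRepModule.seriesToDual`, `IndModule₂.seriesToDual₂`, [CoatesSujatha2006Cyclotomic] §3.3) is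
FUNCTORIAL: an `𝒪`-linear endomorphism `e` of `A`, resp. an additive endomorphism `s` of the value group
`C`, acts on `T_A ⊗ Λ` through the CONSTANT matrix of its `tA`-adjoint. This file proves exactly that:

* §1 `exists_matrix_adjoint_comp` / `exists_matrix_adjoint_map`: for a dual datum `(Y, tA)` of `A` with a
  basis `b : Fin n → Y`, every `𝒪`-linear `e : A → A` and every additive `s : C → C` have ADJOINT MATRICES
  `Q ∈ M_n(𝒪)`: `tA (∑ j, Q j k • b j) a = tA (b k) (e a)`, resp. `= s (tA (b k) a)` (bijectivity and
  balance of `tA`; no commutation hypothesis on `s`); `adjoint_comp_mul` (composition ↦ reversed product),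
  `adjoint_eq_one_of_id`, `isUnit_det_of_adjoint_of_leftInverse` (an invertible `e` has an adjoint matrix
  of unit determinant).
* §2 (one variable) `seriesCoeff_map_mulVec`, **`seriesToDual_map_mulVec_of_comp`**:
  `⟨(Q ⊗ 1) F, Φ⟩ = ⟨F, e_* Φ⟩` (`e_* = BigRepModule.mapRange e`), **`seriesToDual_map_mulVec_of_map`**:
  `⟨(Q ⊗ 1) F, Φ⟩ = s ⟨F, Φ⟩`.
* §3 (two variables, by iterating §2 over `𝒪⟦T⟧`) **`seriesToDual₂_map_mulVec_of_comp`**,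
  **`seriesToDual₂_map_mulVec_of_map`** for `IndModule₂ 𝒪 p A` and `e_** = mapRange (mapRangeₗ e)`.

Pure algebra; theorems only; no definition, no named fact, no `sorry`. HONEST FRAMING: generic bookkeeping;
closes nothing by itself (`--supports stmt-BirchSwinnertonDyer-20727`); no summit statement / BSD is proved
by this file. References: [Greenberg2010] R. Greenberg, *Surjectivity of the global-to-local map defining a
Selmer group*, Kyoto J. Math. 50 (2010), §5 (PDF p. 26), Lemma 5.2.2 (PDF p. 28 L20–21); [Greenberg2006]
Doc. Math. Extra Vol. Coates (2006) p. 342 L4–11, L35–36; [CoatesSujatha2006Cyclotomic] J. Coates,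
R. Sujatha, *Cyclotomic Fields and Zeta Values* (2006), §3.3 Def. 3.3.2 / Thm. 3.3.3 / Lemma 3.3.4 pp. 36–37.
-/

-- `Summit.BirchSwinnertonDyer.BirchSwinnertonDyer.…`: summit and sub-problem share a name (D-0017 layout).
set_option linter.dupNamespace false
set_option autoImplicit false

noncomputable section

open scoped Classical
open Finset PowerSeries Matrix
open Literature.NumberTheory.EllipticCurves Literature.NumberTheory.EllipticCurves.BigRepModule
  Literature.NumberTheory.IwasawaTheory.Greenberg2016 Literature.NumberTheory.IwasawaTheory.Greenberg2006

universe u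

namespace Summit.BirchSwinnertonDyer.BirchSwinnertonDyer.Theorems.SignedBaseChangeAcDivDualFunctorial

/-! ## §1 Adjoint matrices of endomorphisms of `A` and of the value group -/

section Adjoint

variable {𝒪 : Type u} [CommRing 𝒪] {A : Type u} [AddCommGroup A] [Module 𝒪 A]
  {C : Type*} [AddCommGroup C] {Y : Type u} [AddCommGroup Y] [Module 𝒪 Y]
  {tA : Y →+ (A →+ C)} (hY : IsDualPairing 𝒪 A tA) {n : ℕ} (b : Module.Basis (Fin n) 𝒪 Y)

include hY in
/-- **The `tA`-adjoint matrix of an `𝒪`-linear endomorphism `e` of `A`**: `Q ∈ M_n(𝒪)` with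
`⟨∑ⱼ Q j k • bⱼ, a⟩ = ⟨b k, e a⟩` — the transpose `ρ₀*(σ)` of [Greenberg2010] acting on `T* = Hom(D, μ)`
(here for any value group `C`). [cite: Greenberg2010, Lemma 5.2.2 (PDF p. 28 L20–21)] -/
theorem exists_matrix_adjoint_comp (e : A →ₗ[𝒪] A) :
    ∃ Q : Matrix (Fin n) (Fin n) 𝒪, ∀ (k : Fin n) (a : A), tA (∑ j, Q j k • b j) a = tA (b k) (e a) := by
  refine ⟨fun j k ↦ b.repr (hY.addEquiv.symm ((tA (b k)).comp e.toAddMonoidHom)) j, fun k a ↦ ?_⟩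
  have h : ∑ j, (b.repr (hY.addEquiv.symm ((tA (b k)).comp e.toAddMonoidHom)) j) • b j =
      hY.addEquiv.symm ((tA (b k)).comp e.toAddMonoidHom) := b.sum_repr _
  rw [h, hY.apply_addEquiv_symm]
  rfl

include hY in
/-- **The `tA`-adjoint matrix of an additive endomorphism `s` of the value group `C`** (e.g. a Galois
automorphism of `K̄ˣ`): `Q ∈ M_n(𝒪)` with `⟨∑ⱼ Q j k • bⱼ, a⟩ = s ⟨b k, a⟩` — it exists and is a CONSTANT
matrix by the balance of `tA` alone (no cyclotomic character needed). [cite: Greenberg2010, Lemma 5.2.2 (PDF p. 28 L20–21)] -/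
theorem exists_matrix_adjoint_map (s : C →+ C) :
    ∃ Q : Matrix (Fin n) (Fin n) 𝒪, ∀ (k : Fin n) (a : A), tA (∑ j, Q j k • b j) a = s (tA (b k) a) := by
  refine ⟨fun j k ↦ b.repr (hY.addEquiv.symm (s.comp (tA (b k)))) j, fun k a ↦ ?_⟩
  have h : ∑ j, (b.repr (hY.addEquiv.symm (s.comp (tA (b k)))) j) • b j =
      hY.addEquiv.symm (s.comp (tA (b k))) := b.sum_repr _
  rw [h, hY.apply_addEquiv_symm]
  rfl

include hY in
/-- Pairing a combination `∑ⱼ Q j k • bⱼ` against `a` is `∑ⱼ ⟨bⱼ, Q j k • a⟩` (balance).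
[cite: Greenberg2016Selmer, §1 p. 2 L17–35 (Pontryagin duals)] -/
theorem apply_sum_smul_basis (Q : Matrix (Fin n) (Fin n) 𝒪) (k : Fin n) (a : A) :
    tA (∑ j, Q j k • b j) a = ∑ j, tA (b j) (Q j k • a) := by
  rw [map_sum, AddMonoidHom.finsetSum_apply]
  exact Finset.sum_congr rfl fun j _ ↦ hY.map_smul _ _ _

include hY in
/-- **Adjoints reverse composition**: if `Q` is adjoint to `e` and `Q'` to `e'`, then `Q' * Q` is adjoint
to `e ∘ e'`. [cite: Greenberg2010, Lemma 5.2.2 (PDF p. 28 L20–21)] -/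
theorem adjoint_comp_mul {e e' : A →ₗ[𝒪] A} {Q Q' : Matrix (Fin n) (Fin n) 𝒪}
    (hQ : ∀ (k : Fin n) (a : A), tA (∑ j, Q j k • b j) a = tA (b k) (e a))
    (hQ' : ∀ (k : Fin n) (a : A), tA (∑ j, Q' j k • b j) a = tA (b k) (e' a)) (k : Fin n) (a : A) :
    tA (∑ j, (Q' * Q) j k • b j) a = tA (b k) (e (e' a)) := by
  rw [← hQ, apply_sum_smul_basis hY b, apply_sum_smul_basis hY b]
  simp_rw [← map_smul e', ← hQ', apply_sum_smul_basis hY b, smul_smul, Matrix.mul_apply,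
    Finset.sum_smul, map_sum]
  exact Finset.sum_comm

include hY in
/-- The adjoint matrix of the identity is `1`. [cite: Greenberg2010, Lemma 5.2.2 (PDF p. 28 L20–21)] -/
theorem adjoint_eq_one_of_id {Q : Matrix (Fin n) (Fin n) 𝒪}
    (hQ : ∀ (k : Fin n) (a : A), tA (∑ j, Q j k • b j) a = tA (b k) a) : Q = 1 := by
  ext j k
  have hk : ∑ j, Q j k • b j = b k := hY.injective (AddMonoidHom.ext (hQ k))
  have := congrArg (fun y ↦ b.repr y j) hk
  simp only [map_sum, map_smul, Finsupp.coe_finsetSum, Finsupp.coe_smul, Finset.sum_apply,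
    Pi.smul_apply, Module.Basis.repr_self, Finsupp.single_apply, smul_eq_mul, mul_ite, mul_one,
    mul_zero, Finset.sum_ite_eq', Finset.mem_univ, if_true] at this
  rw [this, Matrix.one_apply]
  simp only [eq_comm]

include hY in
/-- **An invertible endomorphism has an adjoint matrix of unit determinant**: from `e (e' a) = a` the
adjoints satisfy `Q' * Q = 1`. (For `e = ρ₀(σ̄)`: the leading coefficient `det ρ₀*(σ)` of Greenberg's
determinant is a unit.) [cite: Greenberg2010, Lemma 5.2.2 (PDF p. 28 L20–21)] -/
theorem isUnit_det_of_adjoint_of_leftInverse [Nontrivial 𝒪] {e e' : A →ₗ[𝒪] A}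
    (hee' : ∀ a : A, e (e' a) = a) {Q Q' : Matrix (Fin n) (Fin n) 𝒪}
    (hQ : ∀ (k : Fin n) (a : A), tA (∑ j, Q j k • b j) a = tA (b k) (e a))
    (hQ' : ∀ (k : Fin n) (a : A), tA (∑ j, Q' j k • b j) a = tA (b k) (e' a)) : IsUnit Q.det := by
  have h1 : Q' * Q = 1 :=
    adjoint_eq_one_of_id hY b fun k a ↦ by rw [adjoint_comp_mul hY b hQ hQ' k a, hee']
  have hdet : Q.det * Q'.det = 1 := by rw [mul_comm, ← Matrix.det_mul, h1, Matrix.det_one]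
  exact IsUnit.of_mul_eq_one _ hdet

end Adjoint

/-! ## §2 One variable: adjoint matrices act on the dual datum `T_A⟦T⟧` of the co-induced module -/

section OneVar

variable {𝒪 : Type u} [CommRing 𝒪] {p : ℕ} [Fact p.Prime] {A : Type u} [AddCommGroup A] [Module 𝒪 A]
  {C : Type*} [AddCommGroup C] {Y : Type u} [AddCommGroup Y] [Module 𝒪 Y] {tA : Y →+ (A →+ C)}
  (hY : IsDualPairing 𝒪 A tA) {n : ℕ} (b : Module.Basis (Fin n) 𝒪 Y)

/-- The coefficients of `(Q ⊗ 1) F` in the basis `b`: `∑ₖ coeffᵢ(Fₖ) • (∑ⱼ Q j k • bⱼ)`.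
[cite: CoatesSujatha2006Cyclotomic, Def. 3.3.2, Thm. 3.3.3 (§3.3 p. 37)] -/
theorem seriesCoeff_map_mulVec (Q : Matrix (Fin n) (Fin n) 𝒪) (F : Fin n → PowerSeries 𝒪) (i : ℕ) :
    seriesCoeff b ((Q.map (PowerSeries.C (R := 𝒪))) *ᵥ F) i =
      ∑ k, PowerSeries.coeff i (F k) • ∑ j, Q j k • b j := by
  simp only [seriesCoeff, Matrix.mulVec, dotProduct, Matrix.map_apply, map_sum,
    PowerSeries.coeff_C_mul, Finset.sum_smul, Finset.smul_sum, smul_smul, mul_comm (Q _ _)]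
  exact Finset.sum_comm

/-- Moments commute with post-composition: `((τ₁-1)^i (e_* Φ))(x) = e (((τ₁-1)^i Φ)(x))`.
[cite: CoatesSujatha2006Cyclotomic, Thm. 3.3.1 (§3.3 p. 36)] -/
theorem shiftSubOne_pow_mapRange_apply (e : A →ₗ[𝒪] A) (i : ℕ) (Φ : BigRepModule 𝒪 p A) (x : ℤ_[p]) :
    ((shiftSubOne : BigRepModule 𝒪 p A →ₗ[𝒪] _) ^ i) (mapRange e Φ) x =
      e (((shiftSubOne : BigRepModule 𝒪 p A →ₗ[𝒪] _) ^ i) Φ x) := by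
  rw [shiftSubOne_pow_eq_X_pow_smul, ← mapRange_powerSeries_smul, ← shiftSubOne_pow_eq_X_pow_smul,
    mapRange_apply]

/-- A nilpotence index of `Φ` is one of `e_* Φ`. [cite: CoatesSujatha2006Cyclotomic, Thm. 3.3.1 (§3.3 p. 36)] -/
theorem shiftSubOne_pow_mapRange_eq_zero (e : A →ₗ[𝒪] A) {N : ℕ} {Φ : BigRepModule 𝒪 p A}
    (hN : ((shiftSubOne : BigRepModule 𝒪 p A →ₗ[𝒪] _) ^ N) Φ = 0) :
    ((shiftSubOne : BigRepModule 𝒪 p A →ₗ[𝒪] _) ^ N) (mapRange e Φ) = 0 := by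
  rw [shiftSubOne_pow_eq_X_pow_smul, ← mapRange_powerSeries_smul, ← shiftSubOne_pow_eq_X_pow_smul, hN,
    map_zero]

include hY in
/-- **Functoriality in `A` (one variable): `⟨(Q ⊗ 1) F, Φ⟩ = ⟨F, e_* Φ⟩`** for the adjoint matrix `Q` of an
`𝒪`-linear `e : A → A` — the transpose `ρ₀*(σ) ⊗ 1` on `T* = T_A* ⊗ Λ`. [cite: Greenberg2010, §5 (PDF p. 26 L3–17), Lemma 5.2.2 (PDF p. 28 L20–21)]
[cite: CoatesSujatha2006Cyclotomic, Def. 3.3.2, Thm. 3.3.3 (§3.3 p. 37)] -/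
theorem seriesToDual_map_mulVec_of_comp (e : A →ₗ[𝒪] A) {Q : Matrix (Fin n) (Fin n) 𝒪}
    (hQ : ∀ (k : Fin n) (a : A), tA (∑ j, Q j k • b j) a = tA (b k) (e a))
    (F : Fin n → PowerSeries 𝒪) (Φ : BigRepModule 𝒪 p A) :
    seriesToDual tA b ((Q.map (PowerSeries.C (R := 𝒪))) *ᵥ F) Φ = seriesToDual tA b F (mapRange e Φ) := by
  have hN := nilIndex_spec Φ
  rw [seriesToDual_apply tA b _ hN, seriesToDual_apply tA b _ (shiftSubOne_pow_mapRange_eq_zero e hN)]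
  refine Finset.sum_congr rfl fun i _ ↦ ?_
  rw [seriesCoeff_map_mulVec, shiftSubOne_pow_mapRange_apply, seriesCoeff, map_sum, map_sum,
    AddMonoidHom.finsetSum_apply, AddMonoidHom.finsetSum_apply]
  refine Finset.sum_congr rfl fun k _ ↦ ?_
  rw [hY.map_smul, hQ, LinearMap.map_smul, hY.map_smul]

include hY in
/-- **Functoriality in the values (one variable): `⟨(Q ⊗ 1) F, Φ⟩ = s ⟨F, Φ⟩`** for the adjoint matrix `Q`
of an additive `s : C → C` — the Galois action on the values `μ_{p^∞}` of `T*`, as a constant matrix.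
[cite: Greenberg2010, Lemma 5.2.2 (PDF p. 28 L20–21)] [cite: CoatesSujatha2006Cyclotomic, Def. 3.3.2, Thm. 3.3.3 (§3.3 p. 37)] -/
theorem seriesToDual_map_mulVec_of_map (s : C →+ C) {Q : Matrix (Fin n) (Fin n) 𝒪}
    (hQ : ∀ (k : Fin n) (a : A), tA (∑ j, Q j k • b j) a = s (tA (b k) a))
    (F : Fin n → PowerSeries 𝒪) (Φ : BigRepModule 𝒪 p A) :
    seriesToDual tA b ((Q.map (PowerSeries.C (R := 𝒪))) *ᵥ F) Φ = s (seriesToDual tA b F Φ) := by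
  have hN := nilIndex_spec Φ
  rw [seriesToDual_apply tA b _ hN, seriesToDual_apply tA b _ hN, map_sum]
  refine Finset.sum_congr rfl fun i _ ↦ ?_
  rw [seriesCoeff_map_mulVec, seriesCoeff, map_sum, map_sum, AddMonoidHom.finsetSum_apply,
    AddMonoidHom.finsetSum_apply, map_sum]
  refine Finset.sum_congr rfl fun k _ ↦ ?_
  rw [hY.map_smul, hQ, hY.map_smul]

/-- The column `∑ⱼ (C Q) j k • δⱼ` of the standard basis of `Fin n → 𝒪⟦T⟧` is `(Q ⊗ 1) δ_k`.
[cite: CoatesSujatha2006Cyclotomic, Def. 3.3.2 (§3.3 p. 37)] -/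
theorem sum_smul_basisFun_eq_mulVec {R : Type u} [CommRing R] (Q : Matrix (Fin n) (Fin n) R) (k : Fin n) :
    ∑ j, Q j k • Pi.basisFun R (Fin n) j = Q *ᵥ Pi.basisFun R (Fin n) k := by
  rw [Pi.basisFun_apply, Matrix.mulVec_single_one]
  ext l
  simp only [Finset.sum_apply, Pi.smul_apply, Pi.basisFun_apply, Pi.single_apply, smul_eq_mul, mul_ite,
    mul_one, mul_zero, Finset.sum_ite_eq, Finset.mem_univ, if_true, Matrix.col_apply]

end OneVar

/-! ## §3 Two variables: adjoint matrices act on the dual datum `T_A ⊗ Λ₂` of `𝐃 = Ind(D)` -/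

section TwoVar

variable {𝒪 : Type u} [CommRing 𝒪] {p : ℕ} [Fact p.Prime] {A : Type u} [AddCommGroup A] [Module 𝒪 A]
  (hA : ∀ a : A, ∃ k : ℕ, p ^ k • a = 0)
  {C : Type*} [AddCommGroup C] {Y : Type u} [AddCommGroup Y] [Module 𝒪 Y] {tA : Y →+ (A →+ C)}
  (hY : IsDualPairing 𝒪 A tA) {n : ℕ} (b : Module.Basis (Fin n) 𝒪 Y)

include hA hY in
/-- **Functoriality in `A` (two variables): `⟨(Q ⊗ 1) G, Ψ⟩ = ⟨G, e_** Ψ⟩`** on the dual datum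
`(Fin n → Λ₂, seriesToDual₂)` of `𝐃 = Ind(D)`, `e_** = mapRange (mapRangeₗ e)` the pointwise action of `e`
— the one-variable statement applied over `𝒪⟦T⟧` to the datum `(Fin n → 𝒪⟦T⟧, seriesToDual tA b)`.
[cite: Greenberg2010, §5 (PDF p. 26 L3–17), Lemma 5.2.2 (PDF p. 28 L20–21)] [cite: Greenberg2006, p. 342 L4–11] -/
theorem seriesToDual₂_map_mulVec_of_comp (e : A →ₗ[𝒪] A) {Q : Matrix (Fin n) (Fin n) 𝒪}
    (hQ : ∀ (k : Fin n) (a : A), tA (∑ j, Q j k • b j) a = tA (b k) (e a))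
    (G : Fin n → PowerSeries (PowerSeries 𝒪)) (Ψ : IndModule₂ 𝒪 p A) :
    IndModule₂.seriesToDual₂ tA b
        (((Q.map (PowerSeries.C (R := 𝒪))).map (PowerSeries.C (R := PowerSeries 𝒪))) *ᵥ G) Ψ =
      IndModule₂.seriesToDual₂ tA b G (mapRange (mapRangeₗ e) Ψ) := by
  have hY' := isDualPairing_seriesToDual (p := p) hA b hY
  refine seriesToDual_map_mulVec_of_comp hY' (Pi.basisFun (PowerSeries 𝒪) (Fin n)) (mapRangeₗ e)
    (Q := Q.map (PowerSeries.C (R := 𝒪))) (fun k Φ ↦ ?_) G Ψ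
  rw [sum_smul_basisFun_eq_mulVec, seriesToDual_map_mulVec_of_comp hY b e hQ, mapRangeₗ_apply]

include hA hY in
/-- **Functoriality in the values (two variables): `⟨(Q ⊗ 1) G, Ψ⟩ = s ⟨G, Ψ⟩`** on the dual datum of
`𝐃 = Ind(D)`, for the adjoint matrix `Q` of an additive `s : C → C`.
[cite: Greenberg2010, Lemma 5.2.2 (PDF p. 28 L20–21)] [cite: Greenberg2006, p. 342 L4–11] -/
theorem seriesToDual₂_map_mulVec_of_map (s : C →+ C) {Q : Matrix (Fin n) (Fin n) 𝒪}
    (hQ : ∀ (k : Fin n) (a : A), tA (∑ j, Q j k • b j) a = s (tA (b k) a))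
    (G : Fin n → PowerSeries (PowerSeries 𝒪)) (Ψ : IndModule₂ 𝒪 p A) :
    IndModule₂.seriesToDual₂ tA b
        (((Q.map (PowerSeries.C (R := 𝒪))).map (PowerSeries.C (R := PowerSeries 𝒪))) *ᵥ G) Ψ =
      s (IndModule₂.seriesToDual₂ tA b G Ψ) := by
  have hY' := isDualPairing_seriesToDual (p := p) hA b hY
  refine seriesToDual_map_mulVec_of_map hY' (Pi.basisFun (PowerSeries 𝒪) (Fin n)) s
    (Q := Q.map (PowerSeries.C (R := 𝒪))) (fun k Φ ↦ ?_) G Ψ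
  rw [sum_smul_basisFun_eq_mulVec, seriesToDual_map_mulVec_of_map hY b s hQ]

end TwoVar

end Summit.BirchSwinnertonDyer.BirchSwinnertonDyer.Theorems.SignedBaseChangeAcDivDualFunctorial

end
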